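import Literature.Analysis.FluidPDE.OseenSlice
import Literature.Analysis.FunctionSpaces.HolderAlgebra
import HarnessLib

/-!
# Hölder data gain one derivative under the Oseen slice operator

Analysis/FluidPDE support file (all results proved; no named facts) on the discharge path of the
regularity of bounded weak solutions of the Navier–Stokes equations,
Koch–Nadirashvili–Seregin–Šverák, Acta Math. 203 (2009) = arXiv:0709.3599, §4 (named facts
`KNSS2009_regularity_boundedWeak_ancient_planar`, `KNSS2009_driftMild_regularity`). The bootstrap
behind (4.9)–(4.10) ("Equation (4.8) gains `ω` one spatial derivative … The standard
bootstrapping arguments …", p. 8) is run in the tree on the mild (Oseen) form, where the gain of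
one derivative per step is the following property of the slice operator
`N_σ[a, b] = e^{σΔ}P∇·(a ⊗ b)` (`oseenSlice`, `OseenSlice.lean`): **if the data are `C^{k,α}`, then
`N_σ[a, b]` has `k + 1` bounded derivatives with the integrable weight `σ^{-1+α/2}`** (and `k + 2`
with the weight `σ^{-3/2+α/2}`, which is what makes the `(k+1)`-st derivative of the time
integral Hölder continuous again). This is KNSS's (3.12) ("taking difference quotients") combined
with the classical mollification trick: split `a = e^{σΔ}a + (a − e^{σΔ}a)`, put the derivative on
the smooth part (`∂(N_σ[a_σ, b_σ]) = N_σ[∂a_σ, b_σ] + N_σ[a_σ, ∂b_σ]`, `‖∂a_σ‖ ≲ σ^{(α−1)/2}[a]_α`)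
and on the kernel for the small rough part (`‖∂N_σ[g, b]‖ ≲ σ⁻¹‖g‖_∞`, `‖a − a_σ‖_∞ ≲ σ^{α/2}[a]_α`),
the two mollification estimates being the tree's `norm_fderiv_heatExtension_le_of_holder`,
`norm_heatExtension_sub_self_le_of_holder` (`HeatKernelBoundedData`).

* `IsHolderField k α A a`: `a ∈ Cᵏ`, `‖Dʲa‖ ≤ A` (`j ≤ k`), `Dᵏa` is `α`-Hölder with constant `A`
  — the *single-constant working form* of the tree's Hölder class
  `Literature.Analysis.FunctionSpaces.MemContDiffHolder k r f` / norm `eContDiffHolderNorm k r f`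
  (`FunctionSpaces/HolderNorm.lean`, `‖f‖_{C^{k,r}} = ∑_{j ≤ k} ‖Dʲf‖_∞ + [Dᵏf]_r`), to which it
  is bridged both ways (`IsHolderField.memContDiffHolder`, `IsHolderField.eContDiffHolderNorm_le`
  with constant `(k + 2)A`, `IsHolderField.of_eContDiffHolderNorm_le`); one real constant and a
  real exponent are what the bootstrap's bookkeeping (`A‖v‖`, `2A`, `A + ‖c‖`, `σ^{-1+α/2}`)
  manipulates. Closure under directional derivatives (`IsHolderField.fderiv_apply`), lowering the
  order (`IsHolderField.of_succ`), adding constants; `IsCkBounded k A a` (sup bounds only).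
* `norm_iteratedFDeriv_succ_le_of_forall_fderiv_apply`: sup bounds on `Dⁿ(∂ᵥf)` for all `v` give
  the sup bound on `Dⁿ⁺¹f` (currying).
* `exists_norm_iteratedFDeriv_oseenSlice_le_of_isCkBounded`: `‖Dⁱ N_σ[a, b]‖ ≤ C σ^{-1/2} A B`
  for `i ≤ k` and `Cᵏ`-bounded data (derivatives fall on the data).
* `exists_holder_gain_oseenSlice`: for `C^{k,α}` data (`0 ≤ α ≤ 1`),
  `‖Dᵏ⁺¹ N_σ[a, b]‖ ≤ C σ^{-1+α/2} A B` and `‖Dᵏ⁺² N_σ[a, b]‖ ≤ C σ^{-3/2+α/2} A B`, with `C`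
  depending on `k` and `dim E` only (induction on `k` from the case `k = 0`,
  `exists_holder_gain_oseenSlice_zero`).

## References

* G. Koch, N. Nadirashvili, G. Seregin, V. Šverák, *Liouville theorems for the Navier–Stokes
  equations and applications*, Acta Math. 203 (2009) 83–105 = arXiv:0709.3599v1: §3
  (3.12)–(3.13), §4 Prop. 4.1 and the closing paragraph, (4.7)–(4.10) (p. 8).
  [KochNadirashviliSereginSverak2009]
* T. Buckmaster, C. De Lellis, L. Székelyhidi Jr., V. Vicol, CPAM 72 (2019), §2.2 (standard
  mollification estimates). [BuckmasterEtAl2018]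
-/

noncomputable section

open MeasureTheory Set Function Filter Metric Real
open _root_.Topology
open scoped ENNReal NNReal RealInnerProductSpace ContDiff

namespace Literature.Analysis.FluidPDE

open UnboundedOperators (heatKernel heatExtension)

variable {E : Type*} [NormedAddCommGroup E]
variable {F : Type*} [NormedAddCommGroup F] [NormedSpace ℝ F]

/-! ### `C^{k,α}` and `Cᵏ`-bounded data (any real normed space `E`) -/

section HolderField

variable [NormedSpace ℝ E]

/-- **`Cᵏ`-bounded data with one constant**: `a ∈ Cᵏ(E; F)` and `‖Dʲa(x)‖ ≤ A` for all `j ≤ k`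
and all `x` (classical derivatives `iteratedFDeriv`; the sup part of the tree's
`Literature.Analysis.FunctionSpaces.eContDiffHolderNorm`, with a single real constant). [folklore] -/
structure IsCkBounded (k : ℕ) (A : ℝ) (a : E → F) : Prop where
  /-- `a` is `Cᵏ`. -/
  contDiff : ContDiff ℝ k a
  /-- all derivatives of order `≤ k` are bounded by `A`. -/
  norm_le : ∀ j ≤ k, ∀ x, ‖iteratedFDeriv ℝ j a x‖ ≤ A

/-- **`C^{k,α}` data with one constant** (Hölder space `C^{k,α}(E; F)`, Gilbarg–Trudinger §4.1,
with all the seminorms bounded by the same real `A` and a real exponent `α`): `a ∈ Cᵏ`,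
`‖Dʲa(x)‖ ≤ A` for `j ≤ k`, and `‖Dᵏa(x) − Dᵏa(y)‖ ≤ A‖x − y‖^α`. This is the working form of the
tree's class `Literature.Analysis.FunctionSpaces.MemContDiffHolder k r a` with
`eContDiffHolderNorm k r a < ∞` (`FunctionSpaces/HolderNorm.lean`); see the bridge lemmas
`IsHolderField.memContDiffHolder`, `IsHolderField.eContDiffHolderNorm_le`,
`IsHolderField.of_eContDiffHolderNorm_le` below. [folklore] -/
structure IsHolderField (k : ℕ) (α A : ℝ) (a : E → F) : Prop where
  /-- `a` is `Cᵏ`. -/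
  contDiff : ContDiff ℝ k a
  /-- all derivatives of order `≤ k` are bounded by `A`. -/
  norm_le : ∀ j ≤ k, ∀ x, ‖iteratedFDeriv ℝ j a x‖ ≤ A
  /-- the top derivative is `α`-Hölder with constant `A`. -/
  holder : ∀ x y, ‖iteratedFDeriv ℝ k a x - iteratedFDeriv ℝ k a y‖ ≤ A * ‖x - y‖ ^ α

variable {k : ℕ} {α A : ℝ} {a : E → F}

/-- `C^{k,α}` data are `Cᵏ`-bounded. [folklore] -/
theorem IsHolderField.isCkBounded (h : IsHolderField k α A a) :
    IsCkBounded k A a :=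
  ⟨h.contDiff, h.norm_le⟩

/-- The constant of `Cᵏ`-bounded data is nonnegative. [folklore] -/
theorem IsCkBounded.nonneg (h : IsCkBounded k A a) : 0 ≤ A :=
  (norm_nonneg _).trans (h.norm_le 0 (Nat.zero_le _) 0)

/-- Sup bound of `Cᵏ`-bounded data: `‖a x‖ ≤ A`. [folklore] -/
theorem IsCkBounded.norm_apply_le (h : IsCkBounded k A a) (x : E) :
    ‖a x‖ ≤ A := by
  have := h.norm_le 0 (Nat.zero_le _) x
  rwa [norm_iteratedFDeriv_zero] at this

/-- Gradient bound of `Cᵏ⁺¹`-bounded data: `‖Da(x)‖ ≤ A`. [folklore] -/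
theorem IsCkBounded.norm_fderiv_le (h : IsCkBounded (k + 1) A a) (x : E) :
    ‖fderiv ℝ a x‖ ≤ A := by
  have := h.norm_le 1 (Nat.le_add_left 1 k) x
  rwa [norm_iteratedFDeriv_one] at this

/-- Lowering the order of `Cᵏ`-bounded data. [folklore] -/
theorem IsCkBounded.of_succ (h : IsCkBounded (k + 1) A a) : IsCkBounded k A a :=
  ⟨h.contDiff.of_le (by exact_mod_cast Nat.le_succ k),
    fun j hj x => h.norm_le j (hj.trans (Nat.le_succ k)) x⟩

/-- Lowering the order of `Cᵏ`-bounded data to any `j ≤ k`. [folklore] -/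
theorem IsCkBounded.of_le {j : ℕ} (h : IsCkBounded k A a) (hj : j ≤ k) : IsCkBounded j A a :=
  ⟨h.contDiff.of_le (by exact_mod_cast hj), fun i hi x => h.norm_le i (hi.trans hj) x⟩

/-- **Directional derivatives of `Cᵏ⁺¹`-bounded data are `Cᵏ`-bounded**, with constant `A‖v‖`
(`‖Dʲ(∂ᵥa)(x)‖ ≤ ‖v‖‖Dʲ⁺¹a(x)‖`). [folklore] -/
theorem IsCkBounded.fderiv_apply (h : IsCkBounded (k + 1) A a) (v : E) :
    IsCkBounded k (A * ‖v‖) (fun y => fderiv ℝ a y v) := by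
  refine ⟨(h.contDiff.fderiv_right (m := k) le_rfl).clm_apply contDiff_const, fun j hj x => ?_⟩
  have hj1 : (j : ℕ∞) + 1 ≤ (k : ℕ∞) + 1 := by exact_mod_cast Nat.succ_le_succ hj
  have hc : ContDiff ℝ (j + 1 : ℕ) a := h.contDiff.of_le (by exact_mod_cast Nat.succ_le_succ hj)
  calc ‖iteratedFDeriv ℝ j (fun y => fderiv ℝ a y v) x‖
      ≤ ‖v‖ * ‖iteratedFDeriv ℝ (j + 1) a x‖ := by
        refine ContinuousMultilinearMap.opNorm_le_bound (by positivity) fun m => ?_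
        rw [show (fun y => fderiv ℝ a y v) = (ContinuousLinearMap.apply ℝ F v) ∘ (fderiv ℝ a)
            from rfl, ContinuousLinearMap.iteratedFDeriv_comp_left _
            ((hc.fderiv_right (m := j) le_rfl).contDiffAt) le_rfl]
        simp only [ContinuousLinearMap.compContinuousMultilinearMap_coe, Function.comp_apply,
          ContinuousLinearMap.apply_apply]
        have key : iteratedFDeriv ℝ j (fderiv ℝ a) x m v =
            iteratedFDeriv ℝ (j + 1) a x (Fin.snoc m v) := by
          rw [iteratedFDeriv_succ_apply_right, Fin.init_snoc, Fin.snoc_last]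
        rw [key]
        refine (ContinuousMultilinearMap.le_opNorm _ _).trans (le_of_eq ?_)
        rw [Fin.prod_univ_castSucc]
        simp only [Fin.snoc_castSucc, Fin.snoc_last]
        ring
    _ ≤ ‖v‖ * A := mul_le_mul_of_nonneg_left (h.norm_le (j + 1) (Nat.succ_le_succ hj) x)
        (norm_nonneg _)
    _ = A * ‖v‖ := mul_comm _ _

/-- The constant of `C^{k,α}` data is nonnegative. [folklore] -/
theorem IsHolderField.nonneg (h : IsHolderField k α A a) : 0 ≤ A :=
  h.isCkBounded.nonneg

/-- Sup bound of `C^{k,α}` data. [folklore] -/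
theorem IsHolderField.norm_apply_le (h : IsHolderField k α A a) (x : E) : ‖a x‖ ≤ A :=
  h.isCkBounded.norm_apply_le x

/-- `C^{k,α}` data are continuous. [folklore] -/
theorem IsHolderField.continuous (h : IsHolderField k α A a) : Continuous a :=
  h.contDiff.continuous

/-- The Hölder clause at order zero: `‖a x − a y‖ ≤ A‖x − y‖^α`. [folklore] -/
theorem IsHolderField.norm_sub_le (h : IsHolderField 0 α A a) (x y : E) :
    ‖a x - a y‖ ≤ A * ‖x - y‖ ^ α := by
  have := h.holder x y
  rwa [iteratedFDeriv_zero_eq_comp, Function.comp_apply, Function.comp_apply, ← map_sub,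
    LinearIsometryEquiv.norm_map] at this

/-- `Dᵏ(∂ᵥa)(x) m = Dᵏ⁺¹a(x) (snoc m v)` for `a ∈ Cᵏ⁺¹`. [folklore] -/
theorem iteratedFDeriv_fderiv_apply_eq_snoc {a : E → F} {k : ℕ} (ha : ContDiff ℝ (k + 1 : ℕ) a)
    (v x : E) (m : Fin k → E) :
    iteratedFDeriv ℝ k (fun y => fderiv ℝ a y v) x m = iteratedFDeriv ℝ (k + 1) a x (Fin.snoc m v) := by
  rw [show (fun y => fderiv ℝ a y v) = (ContinuousLinearMap.apply ℝ F v) ∘ (fderiv ℝ a) from rfl,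
    ContinuousLinearMap.iteratedFDeriv_comp_left _ ((ha.fderiv_right (m := k) le_rfl).contDiffAt)
      le_rfl]
  simp only [ContinuousLinearMap.compContinuousMultilinearMap_coe, Function.comp_apply,
    ContinuousLinearMap.apply_apply]
  rw [iteratedFDeriv_succ_apply_right, Fin.init_snoc, Fin.snoc_last]

/-- Increments version of `IsCkBounded.fderiv_apply`:
`‖Dᵏ(∂ᵥa)(x) − Dᵏ(∂ᵥa)(y)‖ ≤ ‖v‖‖Dᵏ⁺¹a(x) − Dᵏ⁺¹a(y)‖`. [folklore] -/
theorem norm_iteratedFDeriv_fderiv_apply_sub_le_snoc {a : E → F} {k : ℕ}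
    (ha : ContDiff ℝ (k + 1 : ℕ) a) (v x y : E) :
    ‖iteratedFDeriv ℝ k (fun z => fderiv ℝ a z v) x - iteratedFDeriv ℝ k (fun z => fderiv ℝ a z v) y‖ ≤
      ‖v‖ * ‖iteratedFDeriv ℝ (k + 1) a x - iteratedFDeriv ℝ (k + 1) a y‖ := by
  refine ContinuousMultilinearMap.opNorm_le_bound (by positivity) fun m => ?_
  rw [sub_apply, iteratedFDeriv_fderiv_apply_eq_snoc ha, iteratedFDeriv_fderiv_apply_eq_snoc ha,
    ← sub_apply]
  refine (ContinuousMultilinearMap.le_opNorm _ _).trans (le_of_eq ?_)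
  rw [Fin.prod_univ_castSucc]
  simp only [Fin.snoc_castSucc, Fin.snoc_last]
  ring

/-- **Directional derivatives of `C^{k+1,α}` data are `C^{k,α}`**, with constant `A‖v‖`. [folklore] -/
theorem IsHolderField.fderiv_apply (h : IsHolderField (k + 1) α A a) (v : E) :
    IsHolderField k α (A * ‖v‖) (fun y => fderiv ℝ a y v) := by
  have hb := h.isCkBounded.fderiv_apply v
  refine ⟨hb.contDiff, hb.norm_le, fun x y => ?_⟩
  calc ‖iteratedFDeriv ℝ k (fun z => fderiv ℝ a z v) x - iteratedFDeriv ℝ k (fun z => fderiv ℝ a z v) y‖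
      ≤ ‖v‖ * ‖iteratedFDeriv ℝ (k + 1) a x - iteratedFDeriv ℝ (k + 1) a y‖ :=
        norm_iteratedFDeriv_fderiv_apply_sub_le_snoc h.contDiff v x y
    _ ≤ ‖v‖ * (A * ‖x - y‖ ^ α) := mul_le_mul_of_nonneg_left (h.holder x y) (norm_nonneg _)
    _ = A * ‖v‖ * ‖x - y‖ ^ α := by ring

/-- **Lowering the order of `C^{k+1,α}` data** (`0 ≤ α ≤ 1`): `a` is `C^{k,α}` with constant
`2A`, since `Dᵏa` is `A`-Lipschitz (mean value inequality, `‖D(Dᵏa)‖ = ‖Dᵏ⁺¹a‖ ≤ A`) and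
bounded by `A`, and `min(2A, A r) ≤ 2A r^α`. [folklore] -/
theorem IsHolderField.of_succ (h : IsHolderField (k + 1) α A a) (hα0 : 0 ≤ α) (hα1 : α ≤ 1) :
    IsHolderField k α (2 * A) a := by
  have hA := h.nonneg
  have hb := h.isCkBounded.of_succ
  refine ⟨hb.contDiff, fun j hj x => (hb.norm_le j hj x).trans (by linarith), fun x y => ?_⟩
  -- Lipschitz bound from the mean value inequality
  have hdiff : Differentiable ℝ (iteratedFDeriv ℝ k a) :=
    (h.contDiff.differentiable_iteratedFDeriv (by exact_mod_cast Nat.lt_succ_self k))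
  have hlip : ‖iteratedFDeriv ℝ k a x - iteratedFDeriv ℝ k a y‖ ≤ A * ‖x - y‖ := by
    refine Convex.norm_image_sub_le_of_norm_fderiv_le (s := univ) (fun z _ => hdiff z)
      (fun z _ => ?_) convex_univ (mem_univ y) (mem_univ x)
    rw [norm_fderiv_iteratedFDeriv]
    exact h.norm_le (k + 1) le_rfl z
  have hbd : ‖iteratedFDeriv ℝ k a x - iteratedFDeriv ℝ k a y‖ ≤ 2 * A :=
    (_root_.norm_sub_le _ _).trans
      (by linarith [h.norm_le k (Nat.le_succ k) x, h.norm_le k (Nat.le_succ k) y])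
  rcases le_or_gt ‖x - y‖ 1 with hr | hr
  · calc ‖iteratedFDeriv ℝ k a x - iteratedFDeriv ℝ k a y‖ ≤ A * ‖x - y‖ := hlip
      _ ≤ A * ‖x - y‖ ^ α := by
          refine mul_le_mul_of_nonneg_left ?_ hA
          conv_lhs => rw [← Real.rpow_one ‖x - y‖]
          exact Real.rpow_le_rpow_of_exponent_ge' (norm_nonneg _) hr hα0 hα1
      _ ≤ 2 * A * ‖x - y‖ ^ α := by
          have : 0 ≤ A * ‖x - y‖ ^ α := mul_nonneg hA (Real.rpow_nonneg (norm_nonneg _) _)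
          linarith
  · calc ‖iteratedFDeriv ℝ k a x - iteratedFDeriv ℝ k a y‖ ≤ 2 * A := hbd
      _ ≤ 2 * A * ‖x - y‖ ^ α := by
          refine le_mul_of_one_le_right (by linarith) ?_
          exact Real.one_le_rpow hr.le hα0

/-- **Adding a constant to `C^{k,α}` data** costs only the sup bound: `a + c` is `C^{k,α}` with
constant `A + ‖c‖` (the full velocity `u = U + b(t)` of KNSS's decomposition `u = v + w + b`). [folklore] -/
theorem IsHolderField.add_const (h : IsHolderField k α A a) (c : F) :
    IsHolderField k α (A + ‖c‖) (fun y => a y + c) := by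
  have hA := h.nonneg
  have hfun : (fun y => a y + c) = a + fun _ => c := rfl
  have hder : ∀ j ≤ k, ∀ x, iteratedFDeriv ℝ j (fun y => a y + c) x =
      iteratedFDeriv ℝ j a x + iteratedFDeriv ℝ j (fun _ : E => c) x := fun j hj x => by
    rw [hfun]
    exact iteratedFDeriv_add_apply (h.contDiff.of_le (by exact_mod_cast hj)).contDiffAt
      contDiff_const.contDiffAt
  refine ⟨h.contDiff.add contDiff_const, fun j hj x => ?_, fun x y => ?_⟩
  · rw [hder j hj x]
    refine (norm_add_le _ _).trans (add_le_add (h.norm_le j hj x) ?_)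
    rcases Nat.eq_zero_or_pos j with rfl | hj0
    · simp
    · rw [iteratedFDeriv_const_of_ne (Nat.pos_iff_ne_zero.1 hj0)]
      simp
  · rw [hder k le_rfl x, hder k le_rfl y]
    have hc : iteratedFDeriv ℝ k (fun _ : E => c) x = iteratedFDeriv ℝ k (fun _ : E => c) y := by
      rcases Nat.eq_zero_or_pos k with rfl | hk0
      · ext; simp
      · rw [iteratedFDeriv_const_of_ne (Nat.pos_iff_ne_zero.1 hk0)]; rfl
    rw [hc, add_sub_add_right_eq_sub]
    refine (h.holder x y).trans (mul_le_mul_of_nonneg_right (by linarith [norm_nonneg c]) ?_)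
    exact Real.rpow_nonneg (norm_nonneg _) _

/-! ### Bridge to the tree's Hölder classes `MemContDiffHolder` / `eContDiffHolderNorm` -/

omit [NormedSpace ℝ F] [NormedSpace ℝ E] in
/-- A real Hölder bound `‖f x − f y‖ ≤ A‖x − y‖^α` gives Mathlib's `HolderWith` with the
`toNNReal` constant and exponent — the norm form of the tree's general constructor
`Literature.Analysis.FunctionSpaces.holderWith_of_dist_le` (`HolderAlgebra.lean`). [folklore] -/
theorem holderWith_of_norm_sub_le {f : E → F} {A α : ℝ} (hA : 0 ≤ A) (hα : 0 ≤ α)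
    (h : ∀ x y, ‖f x - f y‖ ≤ A * ‖x - y‖ ^ α) :
    HolderWith (Real.toNNReal A) (Real.toNNReal α) f :=
  FunctionSpaces.holderWith_of_dist_le fun x y => by
    rw [dist_eq_norm, dist_eq_norm, Real.coe_toNNReal A hA, Real.coe_toNNReal α hα]
    exact h x y

/-- **Bridge, forward**: `C^{k,α}` data in the single-constant form belong to the tree's class
`MemContDiffHolder k α a` (`0 ≤ α`; exponent `α.toNNReal`). [folklore] -/
theorem IsHolderField.memContDiffHolder (h : IsHolderField k α A a) (hα : 0 ≤ α) :
    FunctionSpaces.MemContDiffHolder k (Real.toNNReal α) a := by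
  refine ⟨h.contDiff, fun j hj => ?_, ?_⟩
  · exact FunctionSpaces.eSupNorm_lt_top_iff.2 ⟨A, h.norm_le j hj⟩
  · exact (holderWith_of_norm_sub_le h.nonneg hα h.holder).memHolder

/-- **Bridge, norm bound**: for `C^{k,α}` data with constant `A`,
`‖a‖_{C^{k,α}} = ∑_{j ≤ k} ‖Dʲa‖_∞ + [Dᵏa]_α ≤ (k + 2) A` in the tree's `eContDiffHolderNorm`.
[folklore] -/
theorem IsHolderField.eContDiffHolderNorm_le (h : IsHolderField k α A a) (hα : 0 ≤ α) :
    FunctionSpaces.eContDiffHolderNorm k (Real.toNNReal α) a ≤ ENNReal.ofReal ((k + 2) * A) := by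
  have hA := h.nonneg
  have hsup : ∀ j ≤ k, FunctionSpaces.eSupNorm (iteratedFDeriv ℝ j a) ≤ ENNReal.ofReal A :=
    fun j hj => iSup_le fun x => by
      rw [← ofReal_norm]; exact ENNReal.ofReal_le_ofReal (h.norm_le j hj x)
  have hH : eHolderNorm (Real.toNNReal α) (iteratedFDeriv ℝ k a) ≤ ENNReal.ofReal A :=
    (holderWith_of_norm_sub_le hA hα h.holder).eHolderNorm_le
  unfold FunctionSpaces.eContDiffHolderNorm
  calc (∑ j ∈ Finset.range (k + 1), FunctionSpaces.eSupNorm (iteratedFDeriv ℝ j a)) +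
        eHolderNorm (Real.toNNReal α) (iteratedFDeriv ℝ k a)
      ≤ (∑ _j ∈ Finset.range (k + 1), ENNReal.ofReal A) + ENNReal.ofReal A :=
        add_le_add (Finset.sum_le_sum fun j hj => hsup j (by
          simpa [Finset.mem_range, Nat.lt_succ_iff] using hj)) hH
    _ = ENNReal.ofReal ((k + 2) * A) := by
        rw [Finset.sum_const, Finset.card_range, nsmul_eq_mul, ← ENNReal.ofReal_natCast,
          ← ENNReal.ofReal_mul (by positivity), ← ENNReal.ofReal_add (by positivity) hA]
        congr 1; push_cast; ring

/-- **Bridge, backward**: a `Cᵏ` function with `‖a‖_{C^{k,r}} ≤ A` in the tree's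
`eContDiffHolderNorm` (`0 ≤ A`) is `C^{k,r}` data in the single-constant form with constant `A`
(each summand of the norm is at most the total). [folklore] -/
theorem IsHolderField.of_eContDiffHolderNorm_le {r : ℝ≥0} (hf : ContDiff ℝ k a) (hA : 0 ≤ A)
    (h : FunctionSpaces.eContDiffHolderNorm k r a ≤ ENNReal.ofReal A) : IsHolderField k r A a := by
  have hsum : ∀ j ≤ k, FunctionSpaces.eSupNorm (iteratedFDeriv ℝ j a) ≤ ENNReal.ofReal A := by
    intro j hj
    refine le_trans ?_ h
    refine le_trans ?_ (le_add_right le_rfl)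
    exact Finset.single_le_sum (f := fun j => FunctionSpaces.eSupNorm (iteratedFDeriv ℝ j a))
      (fun _ _ => zero_le) (Finset.mem_range.2 (Nat.lt_succ_of_le hj))
  have hH : eHolderNorm r (iteratedFDeriv ℝ k a) ≤ ENNReal.ofReal A :=
    le_trans (le_add_left le_rfl) h
  refine ⟨hf, fun j hj x => ?_, fun x y => ?_⟩
  · have := (FunctionSpaces.enorm_le_eSupNorm (iteratedFDeriv ℝ j a) x).trans (hsum j hj)
    rwa [← ofReal_norm, ENNReal.ofReal_le_ofReal_iff hA] at this
  · have hmem : MemHolder r (iteratedFDeriv ℝ k a) :=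
      eHolderNorm_ne_top.1 (ne_top_of_le_ne_top ENNReal.ofReal_ne_top hH)
    have hW := hmem.holderWith
    have hC : (nnHolderNorm r (iteratedFDeriv ℝ k a) : ℝ) ≤ A := by
      have h1 : ((nnHolderNorm r (iteratedFDeriv ℝ k a) : ℝ≥0) : ℝ≥0∞) ≤ ENNReal.ofReal A :=
        coe_nnHolderNorm_le_eHolderNorm.trans hH
      have := ENNReal.toReal_mono ENNReal.ofReal_ne_top h1
      rwa [ENNReal.coe_toReal, ENNReal.toReal_ofReal hA] at this
    calc ‖iteratedFDeriv ℝ k a x - iteratedFDeriv ℝ k a y‖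
        = dist (iteratedFDeriv ℝ k a x) (iteratedFDeriv ℝ k a y) := (dist_eq_norm _ _).symm
      _ ≤ nnHolderNorm r (iteratedFDeriv ℝ k a) * dist x y ^ (r : ℝ) := hW.dist_le x y
      _ ≤ A * ‖x - y‖ ^ (r : ℝ) := by
          rw [dist_eq_norm]
          exact mul_le_mul_of_nonneg_right hC (Real.rpow_nonneg (norm_nonneg _) _)

/-! ### From directional to full derivative bounds -/

/-- **Sup bounds on `Dⁿ(∂ᵥf)` for all `v` bound `Dⁿ⁺¹f`**: if `f ∈ Cⁿ⁺¹` and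
`‖Dⁿ(∂ᵥf)(x)‖ ≤ B‖v‖` for all `v`, then `‖Dⁿ⁺¹f(x)‖ ≤ B` (`Dⁿ⁺¹f(x) m = Dⁿ(∂_{m_last}f)(x)(init m)`,
currying). [folklore] -/
theorem norm_iteratedFDeriv_succ_le_of_forall_fderiv_apply {f : E → F} {n : ℕ}
    (hf : ContDiff ℝ (n + 1 : ℕ) f) {B : ℝ} (hB : 0 ≤ B) {x : E}
    (h : ∀ v, ‖iteratedFDeriv ℝ n (fun y => fderiv ℝ f y v) x‖ ≤ B * ‖v‖) :
    ‖iteratedFDeriv ℝ (n + 1) f x‖ ≤ B := by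
  refine ContinuousMultilinearMap.opNorm_le_bound hB fun m => ?_
  have hm : m = Fin.snoc (Fin.init m) (m (Fin.last n)) := (Fin.snoc_init_self m).symm
  rw [hm, ← iteratedFDeriv_fderiv_apply_eq_snoc hf]
  calc ‖iteratedFDeriv ℝ n (fun y => fderiv ℝ f y (m (Fin.last n))) x (Fin.init m)‖
      ≤ ‖iteratedFDeriv ℝ n (fun y => fderiv ℝ f y (m (Fin.last n))) x‖ * ∏ i, ‖Fin.init m i‖ :=
        ContinuousMultilinearMap.le_opNorm _ _
    _ ≤ B * ‖m (Fin.last n)‖ * ∏ i, ‖Fin.init m i‖ :=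
        mul_le_mul_of_nonneg_right (h _) (Finset.prod_nonneg fun i _ => norm_nonneg _)
    _ = B * ∏ i, ‖(Fin.snoc (Fin.init m) (m (Fin.last n)) : Fin (n + 1) → E) i‖ := by
        rw [Fin.prod_univ_castSucc]
        simp only [Fin.snoc_castSucc, Fin.snoc_last]
        ring

end HolderField

variable [InnerProductSpace ℝ E] [FiniteDimensional ℝ E] [MeasurableSpace E] [BorelSpace E]

/-! ### Low-order sup bounds: derivatives fall on `Cᵏ` data -/

section LowOrder

/-- The directional derivative of a slice of bounded `C¹` data, as a function:
`∂ᵥ N_σ[a, b] = N_σ[∂ᵥa, b] + N_σ[a, ∂ᵥb]`. [cite: KochNadirashviliSereginSverak2009, (3.12) (arXiv:0709.3599v1 p. 6)] -/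
theorem fderiv_oseenSlice_apply_eq_add {σ : ℝ} (hσ : 0 < σ) {a b : E → E} {A B : ℝ}
    (ha : IsCkBounded 1 A a) (hb : IsCkBounded 1 B b) (v : E) :
    (fun y => fderiv ℝ (oseenSlice σ a b) y v) =
      oseenSlice σ (fun y => fderiv ℝ a y v) b + oseenSlice σ a (fun y => fderiv ℝ b y v) := by
  funext y
  exact fderiv_oseenSlice_apply_of_contDiff hσ ha.contDiff hb.contDiff ha.norm_apply_le
    hb.norm_apply_le ha.norm_fderiv_le hb.norm_fderiv_le y v

/-- **Low-order sup bounds** (KNSS 2009, (3.12): derivatives of order `≤ k` fall on `Cᵏ` data):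
for every `k` there is `C = C(k, E)` with `‖Dⁱ N_σ[a, b](x)‖ ≤ C σ^{-1/2} A B` for all `i ≤ k`,
`σ > 0`, and `Cᵏ`-bounded fields `a, b` with constants `A, B`. Induction on `k`: `Dⁱ⁺¹N` is
controlled by `Dⁱ(∂ᵥN) = Dⁱ N[∂ᵥa, b] + Dⁱ N[a, ∂ᵥb]` (`norm_iteratedFDeriv_succ_le_of_forall_fderiv_apply`). [cite: KochNadirashviliSereginSverak2009, (3.12) (arXiv:0709.3599v1 p. 6)] -/
theorem exists_norm_iteratedFDeriv_oseenSlice_le_of_isCkBounded (k : ℕ) :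
    ∃ C : ℝ, 0 ≤ C ∧ ∀ {σ : ℝ}, 0 < σ → ∀ {a b : E → E} {A B : ℝ},
      IsCkBounded k A a → IsCkBounded k B b → ∀ i ≤ k, ∀ x,
        ‖iteratedFDeriv ℝ i (oseenSlice σ a b) x‖ ≤ C * σ ^ (-(1 / 2 : ℝ)) * A * B := by
  obtain ⟨C₀, hC₀, hN⟩ := exists_norm_oseenSlice_le (E := E)
  induction k with
  | zero =>
    refine ⟨C₀, hC₀.le, fun {σ} hσ {a b A B} ha hb i hi x => ?_⟩
    obtain rfl : i = 0 := Nat.le_zero.1 hi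
    rw [norm_iteratedFDeriv_zero]
    exact hN hσ ha.norm_apply_le hb.norm_apply_le x
  | succ k ih =>
    obtain ⟨C, hC, hk⟩ := ih
    refine ⟨max C₀ (2 * C), le_max_of_le_left hC₀.le, fun {σ} hσ {a b A B} ha hb i hi x => ?_⟩
    have hA := ha.nonneg
    have hB := hb.nonneg
    have hσ' : 0 ≤ σ ^ (-(1 / 2 : ℝ)) := Real.rpow_nonneg hσ.le _
    rcases Nat.eq_zero_or_pos i with rfl | hi0
    · rw [norm_iteratedFDeriv_zero]
      refine (hN hσ ha.norm_apply_le hb.norm_apply_le x).trans ?_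
      gcongr
      exact le_max_left _ _
    · obtain ⟨i, rfl⟩ := Nat.exists_eq_succ_of_ne_zero (Nat.pos_iff_ne_zero.1 hi0)
      have hik : i ≤ k := Nat.le_of_succ_le_succ hi
      have hsm : ContDiff ℝ (i + 1 : ℕ) (oseenSlice σ a b) :=
        contDiff_oseenSlice hσ ha.contDiff.continuous.measurable hb.contDiff.continuous.measurable
          ha.norm_apply_le hb.norm_apply_le
      have ha1 : IsCkBounded 1 A a := ⟨ha.contDiff.of_le (by exact_mod_cast Nat.le_add_left 1 k),
        fun j hj y => ha.norm_le j (hj.trans (Nat.le_add_left 1 k)) y⟩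
      have hb1 : IsCkBounded 1 B b := ⟨hb.contDiff.of_le (by exact_mod_cast Nat.le_add_left 1 k),
        fun j hj y => hb.norm_le j (hj.trans (Nat.le_add_left 1 k)) y⟩
      have hbound : ∀ v, ‖iteratedFDeriv ℝ i (fun y => fderiv ℝ (oseenSlice σ a b) y v) x‖ ≤
          2 * C * σ ^ (-(1 / 2 : ℝ)) * A * B * ‖v‖ := by
        intro v
        rw [fderiv_oseenSlice_apply_eq_add hσ ha1 hb1 v]
        have hav := ha.fderiv_apply v
        have hbv := hb.fderiv_apply v
        have h1 := hk hσ hav hb.of_succ i hik x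
        have h2 := hk hσ ha.of_succ hbv i hik x
        have hs1 : ContDiff ℝ i (oseenSlice σ (fun y => fderiv ℝ a y v) b) :=
          contDiff_oseenSlice hσ hav.contDiff.continuous.measurable
            hb.contDiff.continuous.measurable hav.norm_apply_le hb.norm_apply_le
        have hs2 : ContDiff ℝ i (oseenSlice σ a fun y => fderiv ℝ b y v) :=
          contDiff_oseenSlice hσ ha.contDiff.continuous.measurable
            hbv.contDiff.continuous.measurable ha.norm_apply_le hbv.norm_apply_le
        rw [iteratedFDeriv_add_apply hs1.contDiffAt hs2.contDiffAt]
        refine (norm_add_le _ _).trans ?_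
        calc ‖iteratedFDeriv ℝ i (oseenSlice σ (fun y => fderiv ℝ a y v) b) x‖ +
              ‖iteratedFDeriv ℝ i (oseenSlice σ a fun y => fderiv ℝ b y v) x‖
            ≤ C * σ ^ (-(1 / 2 : ℝ)) * (A * ‖v‖) * B + C * σ ^ (-(1 / 2 : ℝ)) * A * (B * ‖v‖) :=
              add_le_add h1 h2
          _ = 2 * C * σ ^ (-(1 / 2 : ℝ)) * A * B * ‖v‖ := by ring
      refine (norm_iteratedFDeriv_succ_le_of_forall_fderiv_apply hsm (by positivity) hbound).trans ?_
      gcongr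
      exact le_max_right _ _

end LowOrder

/-! ### Mollified Hölder data -/

section Mollify

omit [MeasurableSpace E] [BorelSpace E] in
/-- `2^{α/2} ≤ 2` for `α ≤ 1` (in fact `α ≤ 2`). [folklore] -/
theorem two_rpow_half_le_two {α : ℝ} (hα1 : α ≤ 1) : (2 : ℝ) ^ (α / 2) ≤ 2 := by
  conv_rhs => rw [← Real.rpow_one 2]
  exact Real.rpow_le_rpow_of_exponent_le one_le_two (by linarith)

/-- **Heat mollification of Hölder data** (the two "standard mollification estimates" of BDSV
2019, §2.2, for the Gaussian at `ℓ = √σ`, from `HeatKernelBoundedData`, plus smoothness and the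
maximum principle): there is `c = c(E)` such that for `0 ≤ α ≤ 1`, `σ > 0` and `C^{0,α}` data `a`
with constant `A`, the caloric extension `a_σ = e^{σΔ}a` is `C¹` with `‖a_σ‖ ≤ A`,
`‖Da_σ‖ ≤ c σ^{-1/2+α/2} A` and `‖a − a_σ‖ ≤ c σ^{α/2} A`. [cite: BuckmasterEtAl2018, §2.2 (standard mollification estimates)] -/
theorem exists_heatExtension_mollify_holder [CompleteSpace F] :
    ∃ c : ℝ, 0 ≤ c ∧ ∀ {σ α : ℝ}, 0 < σ → 0 ≤ α → α ≤ 1 → ∀ {a : E → F} {A : ℝ},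
      IsHolderField 0 α A a →
        ContDiff ℝ 1 (heatExtension a σ) ∧ (∀ y, ‖heatExtension a σ y‖ ≤ A) ∧
        (∀ y, ‖fderiv ℝ (heatExtension a σ) y‖ ≤ c * σ ^ (-(1 / 2 : ℝ) + α / 2) * A) ∧
        (∀ y, ‖a y - heatExtension a σ y‖ ≤ c * σ ^ (α / 2) * A) := by
  set d2 : ℝ := (2 : ℝ) ^ ((Module.finrank ℝ E : ℝ) / 2) with hd2
  set cH : ℝ := 1 + 2 * d2 with hcH
  have hd2p : 0 < d2 := by positivity
  have hcHp : 0 < cH := by positivity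
  refine ⟨max (d2 * cH * 2) cH, by positivity, fun {σ α} hσ hα0 hα1 {a A} ha => ?_⟩
  have hA := ha.nonneg
  have hcont := ha.continuous
  have hbd := ha.norm_apply_le
  have hH := ha.norm_sub_le
  refine ⟨UnboundedOperators.contDiff_heatExtension_of_bound hcont hbd hσ,
    fun y => UnboundedOperators.norm_heatExtension_le_of_bound hbd hσ y, fun y => ?_, fun y => ?_⟩
  · have h := UnboundedOperators.norm_fderiv_heatExtension_le_of_holder hcont hbd hA hα0 hα1 hH hσ y
    refine h.trans ?_
    have h2σ : (2 * σ) ^ (α / 2) = 2 ^ (α / 2) * σ ^ (α / 2) :=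
      Real.mul_rpow zero_le_two hσ.le
    have hexp : σ ^ (-(1 / 2 : ℝ) + α / 2) = σ ^ (-(1 / 2 : ℝ)) * σ ^ (α / 2) := Real.rpow_add hσ _ _
    rw [h2σ, hexp]
    have h22 := two_rpow_half_le_two hα1
    have hσ1 : 0 ≤ σ ^ (-(1 / 2 : ℝ)) := Real.rpow_nonneg hσ.le _
    have hσ2 : 0 ≤ σ ^ (α / 2) := Real.rpow_nonneg hσ.le _
    calc d2 * σ ^ (-(1 / 2 : ℝ)) * (cH * (2 ^ (α / 2) * σ ^ (α / 2))) * A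
        = (d2 * cH * 2 ^ (α / 2)) * (σ ^ (-(1 / 2 : ℝ)) * σ ^ (α / 2)) * A := by ring
      _ ≤ (d2 * cH * 2) * (σ ^ (-(1 / 2 : ℝ)) * σ ^ (α / 2)) * A := by gcongr
      _ ≤ max (d2 * cH * 2) cH * (σ ^ (-(1 / 2 : ℝ)) * σ ^ (α / 2)) * A := by
          gcongr; exact le_max_left _ _
  · rw [norm_sub_rev]
    refine (UnboundedOperators.norm_heatExtension_sub_self_le_of_holder hcont hbd hA hα0 hα1 hH hσ
      y).trans ?_
    have hσ2 : 0 ≤ σ ^ (α / 2) := Real.rpow_nonneg hσ.le _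
    calc cH * A * σ ^ (α / 2) = cH * σ ^ (α / 2) * A := by ring
      _ ≤ max (d2 * cH * 2) cH * σ ^ (α / 2) * A := by gcongr; exact le_max_right _ _

end Mollify

/-! ### The Hölder gain at order zero -/

section GainZero

/-- **Hölder data gain one derivative, order zero** (KNSS 2009, (3.12)–(3.13) with the
mollification trick of the module docstring): there is `C = C(E)` such that for `σ > 0`,
`0 ≤ α ≤ 1` (`α = 0`: bounded continuous data, up to the constant `2A`) and `C^{0,α}` fields
`a, b` with constants `A, B`,
`‖D N_σ[a, b](x)‖ ≤ C σ^{-1+α/2} A B` and `‖D² N_σ[a, b](x)‖ ≤ C σ^{-3/2+α/2} A B`. [cite: KochNadirashviliSereginSverak2009, (3.12)–(3.13) and §4 (4.9)–(4.10) (arXiv:0709.3599v1 pp. 6–8)] -/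
theorem exists_holder_gain_oseenSlice_zero :
    ∃ C : ℝ, 0 ≤ C ∧ ∀ {σ α : ℝ}, 0 < σ → 0 ≤ α → α ≤ 1 → ∀ {a b : E → E} {A B : ℝ},
      IsHolderField 0 α A a → IsHolderField 0 α B b → ∀ x,
        ‖iteratedFDeriv ℝ 1 (oseenSlice σ a b) x‖ ≤ C * σ ^ (-1 + α / 2) * A * B ∧
        ‖iteratedFDeriv ℝ 2 (oseenSlice σ a b) x‖ ≤ C * σ ^ (-(3 / 2 : ℝ) + α / 2) * A * B := by
  obtain ⟨C₀, hC₀, hN⟩ := exists_norm_oseenSlice_le (E := E)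
  obtain ⟨C₁, hC₁, hD1⟩ := exists_norm_iteratedFDeriv_oseenSlice_le (E := E) 1
  obtain ⟨C₂, hC₂, hD2⟩ := exists_norm_iteratedFDeriv_oseenSlice_le (E := E) 2
  obtain ⟨c, hc, hmol⟩ := exists_heatExtension_mollify_holder (E := E) (F := E)
  refine ⟨4 * (C₀ + C₁ + C₂) * c, by positivity, fun {σ α} hσ hα hα1 {a b A B} ha hb x => ?_⟩
  have hA := ha.nonneg
  have hB := hb.nonneg
  -- clean exponents for the first- and second-order slice bounds
  have hD1' : ∀ {a b : E → E} {Ma Mb : ℝ}, Measurable a → Measurable b → (∀ y, ‖a y‖ ≤ Ma) →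
      (∀ y, ‖b y‖ ≤ Mb) → ∀ x, ‖iteratedFDeriv ℝ 1 (oseenSlice σ a b) x‖ ≤
        C₁ * σ ^ (-(1 : ℝ)) * Ma * Mb := fun ham hbm ha hb x => by
    have := hD1 hσ ham hbm ha hb x; convert this using 3; norm_num
  have hD2' : ∀ {a b : E → E} {Ma Mb : ℝ}, Measurable a → Measurable b → (∀ y, ‖a y‖ ≤ Ma) →
      (∀ y, ‖b y‖ ≤ Mb) → ∀ x, ‖iteratedFDeriv ℝ 2 (oseenSlice σ a b) x‖ ≤
        C₂ * σ ^ (-(3 / 2 : ℝ)) * Ma * Mb := fun ham hbm ha hb x => by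
    have := hD2 hσ ham hbm ha hb x; convert this using 3; norm_num
  have hexp1 : σ ^ (-(1 / 2 : ℝ)) * σ ^ (-(1 / 2 : ℝ) + α / 2) = σ ^ (-1 + α / 2) := by
    rw [← Real.rpow_add hσ]; congr 1; ring
  have hexp2 : σ ^ (-(1 : ℝ)) * σ ^ (α / 2) = σ ^ (-1 + α / 2) := by
    rw [← Real.rpow_add hσ]
  have hexp3 : σ ^ (-(1 : ℝ)) * σ ^ (-(1 / 2 : ℝ) + α / 2) = σ ^ (-(3 / 2 : ℝ) + α / 2) := by
    rw [← Real.rpow_add hσ]; congr 1; ring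
  have hexp4 : σ ^ (-(3 / 2 : ℝ)) * σ ^ (α / 2) = σ ^ (-(3 / 2 : ℝ) + α / 2) := by
    rw [← Real.rpow_add hσ]
  have hX1 : 0 ≤ σ ^ (-1 + α / 2) * A * B := by positivity
  have hX2 : 0 ≤ σ ^ (-(3 / 2 : ℝ) + α / 2) * A * B := by positivity
  -- mollified data
  obtain ⟨haε1, haεb, hDaε, hga⟩ := hmol hσ hα hα1 ha
  obtain ⟨hbε1, hbεb, hDbε, hkb⟩ := hmol hσ hα hα1 hb
  set aε : E → E := heatExtension a σ with haε_def
  set bε : E → E := heatExtension b σ with hbε_def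
  set g : E → E := fun y => a y - aε y with hg_def
  set kk : E → E := fun y => b y - bε y with hkk_def
  have ham : Measurable a := ha.continuous.measurable
  have hbm : Measurable b := hb.continuous.measurable
  have haεm : Measurable aε := haε1.continuous.measurable
  have hbεm : Measurable bε := hbε1.continuous.measurable
  have hgm : Measurable g := ham.sub haεm
  have hkkm : Measurable kk := hbm.sub hbεm
  have hab := ha.norm_apply_le
  have hbb := hb.norm_apply_le
  -- the decomposition `N[a,b] = N[aε,bε] + (N[aε,kk] + N[g,b])`
  have hsplit : oseenSlice σ a b = oseenSlice σ aε bε + (oseenSlice σ aε kk + oseenSlice σ g b) := by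
    funext y
    have e1 : a = aε + g := by funext z; simp [hg_def]
    have e2 : b = bε + kk := by funext z; simp [hkk_def]
    have i1 := integrable_oseenKernel_slice_of_bound hσ haεm.aestronglyMeasurable
      hbm.aestronglyMeasurable haεb hbb y
    have i2 := integrable_oseenKernel_slice_of_bound hσ hgm.aestronglyMeasurable
      hbm.aestronglyMeasurable hga hbb y
    have i3 := integrable_oseenKernel_slice_of_bound hσ haεm.aestronglyMeasurable
      hbεm.aestronglyMeasurable haεb hbεb y
    have i4 := integrable_oseenKernel_slice_of_bound hσ haεm.aestronglyMeasurable
      hkkm.aestronglyMeasurable haεb hkb y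
    simp only [Pi.add_apply]
    conv_lhs => rw [e1]
    rw [oseenSlice_add_left i1 i2,
      show oseenSlice σ aε b y = oseenSlice σ aε bε y + oseenSlice σ aε kk y by
        conv_lhs => rw [e2]
        exact oseenSlice_add_right i3 i4]
    abel
  -- smoothness of the three pieces
  have hs1 : ContDiff ℝ 2 (oseenSlice σ aε bε) := contDiff_oseenSlice hσ haεm hbεm haεb hbεb
  have hs2 : ContDiff ℝ 2 (oseenSlice σ aε kk) := contDiff_oseenSlice hσ haεm hkkm haεb hkb
  have hs3 : ContDiff ℝ 2 (oseenSlice σ g b) := contDiff_oseenSlice hσ hgm hbm hga hbb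
  have hs23 : ContDiff ℝ 2 (oseenSlice σ aε kk + oseenSlice σ g b) := hs2.add hs3
  have hsum : ∀ i ≤ 2, ‖iteratedFDeriv ℝ i (oseenSlice σ a b) x‖ ≤
      ‖iteratedFDeriv ℝ i (oseenSlice σ aε bε) x‖ + (‖iteratedFDeriv ℝ i (oseenSlice σ aε kk) x‖ +
        ‖iteratedFDeriv ℝ i (oseenSlice σ g b) x‖) := by
    intro i hi
    have hi' : (i : WithTop ℕ∞) ≤ 2 := by exact_mod_cast hi
    rw [hsplit, iteratedFDeriv_add_apply (hs1.of_le hi').contDiffAt (hs23.of_le hi').contDiffAt,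
      iteratedFDeriv_add_apply (hs2.of_le hi').contDiffAt (hs3.of_le hi').contDiffAt]
    exact (norm_add_le _ _).trans (add_le_add le_rfl (norm_add_le _ _))
  -- directional derivatives of the mollified data
  have hdir : ∀ v, (Measurable fun y => fderiv ℝ aε y v) ∧ (Measurable fun y => fderiv ℝ bε y v) ∧
      (∀ y, ‖fderiv ℝ aε y v‖ ≤ c * σ ^ (-(1 / 2 : ℝ) + α / 2) * A * ‖v‖) ∧
      (∀ y, ‖fderiv ℝ bε y v‖ ≤ c * σ ^ (-(1 / 2 : ℝ) + α / 2) * B * ‖v‖) := fun v =>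
    ⟨((haε1.continuous_fderiv one_ne_zero).clm_apply continuous_const).measurable,
      ((hbε1.continuous_fderiv one_ne_zero).clm_apply continuous_const).measurable,
      fun y => (ContinuousLinearMap.le_opNorm _ _).trans
        (mul_le_mul_of_nonneg_right (hDaε y) (norm_nonneg _)),
      fun y => (ContinuousLinearMap.le_opNorm _ _).trans
        (mul_le_mul_of_nonneg_right (hDbε y) (norm_nonneg _))⟩
  constructor
  · -- first order
    have hT1 : ‖iteratedFDeriv ℝ 1 (oseenSlice σ aε bε) x‖ ≤ 2 * C₀ * c * (σ ^ (-1 + α / 2) * A * B) := by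
      rw [norm_iteratedFDeriv_one]
      refine ContinuousLinearMap.opNorm_le_bound _ (by positivity) fun v => ?_
      obtain ⟨-, -, hav, hbv⟩ := hdir v
      rw [fderiv_oseenSlice_apply_of_contDiff hσ haε1 hbε1 haεb hbεb hDaε hDbε x v]
      refine (norm_add_le _ _).trans ?_
      calc ‖oseenSlice σ (fun y => fderiv ℝ aε y v) bε x‖ + ‖oseenSlice σ aε (fun y => fderiv ℝ bε y v) x‖
          ≤ C₀ * σ ^ (-(1 / 2 : ℝ)) * (c * σ ^ (-(1 / 2 : ℝ) + α / 2) * A * ‖v‖) * B +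
            C₀ * σ ^ (-(1 / 2 : ℝ)) * A * (c * σ ^ (-(1 / 2 : ℝ) + α / 2) * B * ‖v‖) :=
            add_le_add (hN hσ hav hbεb x) (hN hσ haεb hbv x)
        _ = 2 * C₀ * c * ((σ ^ (-(1 / 2 : ℝ)) * σ ^ (-(1 / 2 : ℝ) + α / 2)) * A * B) * ‖v‖ := by ring
        _ = 2 * C₀ * c * (σ ^ (-1 + α / 2) * A * B) * ‖v‖ := by rw [hexp1]
    have hT2 : ‖iteratedFDeriv ℝ 1 (oseenSlice σ aε kk) x‖ ≤ C₁ * c * (σ ^ (-1 + α / 2) * A * B) := by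
      calc ‖iteratedFDeriv ℝ 1 (oseenSlice σ aε kk) x‖ ≤ C₁ * σ ^ (-(1 : ℝ)) * A * (c * σ ^ (α / 2) * B) :=
            hD1' haεm hkkm haεb hkb x
        _ = C₁ * c * ((σ ^ (-(1 : ℝ)) * σ ^ (α / 2)) * A * B) := by ring
        _ = _ := by rw [hexp2]
    have hT3 : ‖iteratedFDeriv ℝ 1 (oseenSlice σ g b) x‖ ≤ C₁ * c * (σ ^ (-1 + α / 2) * A * B) := by
      calc ‖iteratedFDeriv ℝ 1 (oseenSlice σ g b) x‖ ≤ C₁ * σ ^ (-(1 : ℝ)) * (c * σ ^ (α / 2) * A) * B :=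
            hD1' hgm hbm hga hbb x
        _ = C₁ * c * ((σ ^ (-(1 : ℝ)) * σ ^ (α / 2)) * A * B) := by ring
        _ = _ := by rw [hexp2]
    have hrest : 0 ≤ (2 * C₀ * c + 2 * C₁ * c + 4 * C₂ * c) * (σ ^ (-1 + α / 2) * A * B) := by
      positivity
    calc ‖iteratedFDeriv ℝ 1 (oseenSlice σ a b) x‖
        ≤ 2 * C₀ * c * (σ ^ (-1 + α / 2) * A * B) + (C₁ * c * (σ ^ (-1 + α / 2) * A * B) +
            C₁ * c * (σ ^ (-1 + α / 2) * A * B)) := (hsum 1 (by norm_num)).trans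
              (add_le_add hT1 (add_le_add hT2 hT3))
      _ ≤ 4 * (C₀ + C₁ + C₂) * c * σ ^ (-1 + α / 2) * A * B := by nlinarith
  · -- second order
    have hT1 : ‖iteratedFDeriv ℝ 2 (oseenSlice σ aε bε) x‖ ≤
        2 * C₁ * c * (σ ^ (-(3 / 2 : ℝ) + α / 2) * A * B) := by
      refine norm_iteratedFDeriv_succ_le_of_forall_fderiv_apply hs1 (by positivity) fun v => ?_
      obtain ⟨havm, hbvm, hav, hbv⟩ := hdir v
      have hfun : (fun y => fderiv ℝ (oseenSlice σ aε bε) y v) =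
          oseenSlice σ (fun y => fderiv ℝ aε y v) bε + oseenSlice σ aε (fun y => fderiv ℝ bε y v) := by
        funext y
        exact fderiv_oseenSlice_apply_of_contDiff hσ haε1 hbε1 haεb hbεb hDaε hDbε y v
      have hc1 : ContDiff ℝ 1 (oseenSlice σ (fun y => fderiv ℝ aε y v) bε) :=
        contDiff_oseenSlice hσ havm hbεm hav hbεb
      have hc2 : ContDiff ℝ 1 (oseenSlice σ aε fun y => fderiv ℝ bε y v) :=
        contDiff_oseenSlice hσ haεm hbvm haεb hbv
      rw [hfun, iteratedFDeriv_add_apply hc1.contDiffAt hc2.contDiffAt]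
      refine (norm_add_le _ _).trans ?_
      calc ‖iteratedFDeriv ℝ 1 (oseenSlice σ (fun y => fderiv ℝ aε y v) bε) x‖ +
            ‖iteratedFDeriv ℝ 1 (oseenSlice σ aε fun y => fderiv ℝ bε y v) x‖
          ≤ C₁ * σ ^ (-(1 : ℝ)) * (c * σ ^ (-(1 / 2 : ℝ) + α / 2) * A * ‖v‖) * B +
            C₁ * σ ^ (-(1 : ℝ)) * A * (c * σ ^ (-(1 / 2 : ℝ) + α / 2) * B * ‖v‖) :=
            add_le_add (hD1' havm hbεm hav hbεb x) (hD1' haεm hbvm haεb hbv x)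
        _ = 2 * C₁ * c * ((σ ^ (-(1 : ℝ)) * σ ^ (-(1 / 2 : ℝ) + α / 2)) * A * B) * ‖v‖ := by ring
        _ = 2 * C₁ * c * (σ ^ (-(3 / 2 : ℝ) + α / 2) * A * B) * ‖v‖ := by rw [hexp3]
    have hT2 : ‖iteratedFDeriv ℝ 2 (oseenSlice σ aε kk) x‖ ≤
        C₂ * c * (σ ^ (-(3 / 2 : ℝ) + α / 2) * A * B) := by
      calc ‖iteratedFDeriv ℝ 2 (oseenSlice σ aε kk) x‖
          ≤ C₂ * σ ^ (-(3 / 2 : ℝ)) * A * (c * σ ^ (α / 2) * B) := hD2' haεm hkkm haεb hkb x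
        _ = C₂ * c * ((σ ^ (-(3 / 2 : ℝ)) * σ ^ (α / 2)) * A * B) := by ring
        _ = _ := by rw [hexp4]
    have hT3 : ‖iteratedFDeriv ℝ 2 (oseenSlice σ g b) x‖ ≤
        C₂ * c * (σ ^ (-(3 / 2 : ℝ) + α / 2) * A * B) := by
      calc ‖iteratedFDeriv ℝ 2 (oseenSlice σ g b) x‖
          ≤ C₂ * σ ^ (-(3 / 2 : ℝ)) * (c * σ ^ (α / 2) * A) * B := hD2' hgm hbm hga hbb x
        _ = C₂ * c * ((σ ^ (-(3 / 2 : ℝ)) * σ ^ (α / 2)) * A * B) := by ring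
        _ = _ := by rw [hexp4]
    have hrest : 0 ≤ (4 * C₀ * c + 2 * C₁ * c + 2 * C₂ * c) * (σ ^ (-(3 / 2 : ℝ) + α / 2) * A * B) := by
      positivity
    calc ‖iteratedFDeriv ℝ 2 (oseenSlice σ a b) x‖
        ≤ 2 * C₁ * c * (σ ^ (-(3 / 2 : ℝ) + α / 2) * A * B) +
            (C₂ * c * (σ ^ (-(3 / 2 : ℝ) + α / 2) * A * B) +
              C₂ * c * (σ ^ (-(3 / 2 : ℝ) + α / 2) * A * B)) := (hsum 2 le_rfl).trans
              (add_le_add hT1 (add_le_add hT2 hT3))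
      _ ≤ 4 * (C₀ + C₁ + C₂) * c * σ ^ (-(3 / 2 : ℝ) + α / 2) * A * B := by nlinarith

end GainZero

/-! ### The Hölder gain at every order -/

section Gain

/-- **Hölder data gain one derivative under the slice operator, every order** (the analytic
content of KNSS 2009's bootstrap (4.9)–(4.10), in mild form): for every `k` there is
`C = C(k, E)` such that for `σ > 0`, `0 ≤ α ≤ 1` and `C^{k,α}` fields `a, b` with constants
`A, B`, `‖Dᵏ⁺¹ N_σ[a, b](x)‖ ≤ C σ^{-1+α/2} A B` and `‖Dᵏ⁺² N_σ[a, b](x)‖ ≤ C σ^{-3/2+α/2} A B`.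
Induction on `k`: `Dᵏ⁺²N` is controlled by `Dᵏ⁺¹(∂ᵥN) = Dᵏ⁺¹N[∂ᵥa, b] + Dᵏ⁺¹N[a, ∂ᵥb]` with
`∂ᵥa ∈ C^{k,α}` (constant `A‖v‖`) and `b ∈ C^{k,α}` (constant `2B`). [cite: KochNadirashviliSereginSverak2009, (3.12)–(3.13) and §4 (4.9)–(4.10) (arXiv:0709.3599v1 pp. 6–8)] -/
theorem exists_holder_gain_oseenSlice (k : ℕ) :
    ∃ C : ℝ, 0 ≤ C ∧ ∀ {σ α : ℝ}, 0 < σ → 0 ≤ α → α ≤ 1 → ∀ {a b : E → E} {A B : ℝ},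
      IsHolderField k α A a → IsHolderField k α B b → ∀ x,
        ‖iteratedFDeriv ℝ (k + 1) (oseenSlice σ a b) x‖ ≤ C * σ ^ (-1 + α / 2) * A * B ∧
        ‖iteratedFDeriv ℝ (k + 2) (oseenSlice σ a b) x‖ ≤ C * σ ^ (-(3 / 2 : ℝ) + α / 2) * A * B := by
  induction k with
  | zero => exact exists_holder_gain_oseenSlice_zero
  | succ k ih =>
    obtain ⟨C, hC, hk⟩ := ih
    refine ⟨4 * C, by positivity, fun {σ α} hσ hα hα1 {a b A B} ha hb x => ?_⟩
    have hA := ha.nonneg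
    have hB := hb.nonneg
    have ham : Measurable a := ha.continuous.measurable
    have hbm : Measurable b := hb.continuous.measurable
    have hsm : ContDiff ℝ ∞ (oseenSlice σ a b) :=
      contDiff_oseenSlice hσ ham hbm ha.norm_apply_le hb.norm_apply_le
    have ha1 : IsCkBounded 1 A a := ha.isCkBounded.of_le (Nat.le_add_left 1 k)
    have hb1 : IsCkBounded 1 B b := hb.isCkBounded.of_le (Nat.le_add_left 1 k)
    -- the two bounds on `Dʲ(∂ᵥN)`, `j = k + 1, k + 2`
    have hdir : ∀ v, ‖iteratedFDeriv ℝ (k + 1) (fun y => fderiv ℝ (oseenSlice σ a b) y v) x‖ ≤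
        4 * C * σ ^ (-1 + α / 2) * A * B * ‖v‖ ∧
        ‖iteratedFDeriv ℝ (k + 2) (fun y => fderiv ℝ (oseenSlice σ a b) y v) x‖ ≤
        4 * C * σ ^ (-(3 / 2 : ℝ) + α / 2) * A * B * ‖v‖ := by
      intro v
      rw [fderiv_oseenSlice_apply_eq_add hσ ha1 hb1 v]
      have hav := ha.fderiv_apply v
      have hbv := hb.fderiv_apply v
      have ha' := ha.of_succ hα hα1
      have hb' := hb.of_succ hα hα1
      have h1 := hk hσ hα hα1 hav hb' x
      have h2 := hk hσ hα hα1 ha' hbv x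
      have hs1 : ContDiff ℝ ∞ (oseenSlice σ (fun y => fderiv ℝ a y v) b) :=
        contDiff_oseenSlice hσ hav.continuous.measurable hbm hav.norm_apply_le hb.norm_apply_le
      have hs2 : ContDiff ℝ ∞ (oseenSlice σ a fun y => fderiv ℝ b y v) :=
        contDiff_oseenSlice hσ ham hbv.continuous.measurable ha.norm_apply_le hbv.norm_apply_le
      constructor
      · rw [iteratedFDeriv_add_apply (contDiff_infty.1 hs1 (k + 1)).contDiffAt
          (contDiff_infty.1 hs2 (k + 1)).contDiffAt]
        refine (norm_add_le _ _).trans ?_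
        calc ‖iteratedFDeriv ℝ (k + 1) (oseenSlice σ (fun y => fderiv ℝ a y v) b) x‖ +
              ‖iteratedFDeriv ℝ (k + 1) (oseenSlice σ a fun y => fderiv ℝ b y v) x‖
            ≤ C * σ ^ (-1 + α / 2) * (A * ‖v‖) * (2 * B) + C * σ ^ (-1 + α / 2) * (2 * A) * (B * ‖v‖) :=
              add_le_add h1.1 h2.1
          _ = 4 * C * σ ^ (-1 + α / 2) * A * B * ‖v‖ := by ring
      · rw [iteratedFDeriv_add_apply (contDiff_infty.1 hs1 (k + 2)).contDiffAt
          (contDiff_infty.1 hs2 (k + 2)).contDiffAt]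
        refine (norm_add_le _ _).trans ?_
        calc ‖iteratedFDeriv ℝ (k + 2) (oseenSlice σ (fun y => fderiv ℝ a y v) b) x‖ +
              ‖iteratedFDeriv ℝ (k + 2) (oseenSlice σ a fun y => fderiv ℝ b y v) x‖
            ≤ C * σ ^ (-(3 / 2 : ℝ) + α / 2) * (A * ‖v‖) * (2 * B) +
                C * σ ^ (-(3 / 2 : ℝ) + α / 2) * (2 * A) * (B * ‖v‖) :=
              add_le_add h1.2 h2.2
          _ = 4 * C * σ ^ (-(3 / 2 : ℝ) + α / 2) * A * B * ‖v‖ := by ring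
    exact ⟨norm_iteratedFDeriv_succ_le_of_forall_fderiv_apply (n := k + 1)
        (contDiff_infty.1 hsm (k + 1 + 1)) (by positivity) fun v => (hdir v).1,
      norm_iteratedFDeriv_succ_le_of_forall_fderiv_apply (n := k + 2)
        (contDiff_infty.1 hsm (k + 2 + 1)) (by positivity) fun v => (hdir v).2⟩

end Gain

end Literature.Analysis.FluidPDE

end
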